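import Literature.MathematicalPhysics.QuantumLattice.DWaveSourceNNNHoppingFlatTwistOrderParameter
import Literature.MathematicalPhysics.QuantumLattice.DWaveSourceNNNHoppingFlatTwistEnergyDensitySymmetry
import Literature.MathematicalPhysics.QuantumLattice.SourcedGroundEnergyCusp
import Literature.MathematicalPhysics.QuantumLattice.GroundStateSourceBounds
import HarnessLib

/-!
# The flat-twisted sourced energy density `e_src^tw(·;κ)` is concave and Lipschitz in the source; its cusp at
# `h = 0` is the Fulde–Ferrell / pair-density-wave order parameter `m⋆_κ`; and the small-field slope of the
# sourced helicity chord density is the DEFICIT of pair-density-wave order: `σ(h;κ)/(2h) → m⋆ − m⋆_κ`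

Topic `Literature/MathematicalPhysics/QuantumLattice` (namespace = path; family `hubbard`). The theorems behind
`DWaveSourceNNNHoppingFlatTwistOrderParameter.lean` (`dWaveSourceDensityTT'Twist L t' U μ h n`, the `d`-wave pair
amplitude per site of the tracial ground state of the TWISTED sourced torus — in the gauge picture the spiral pair
amplitude, a reading not typed here; `dWaveOrderParameterTT'Twist t' U μ κ = m⋆_κ = ⨅_{h>0} (e^tw(0;κ) − e^tw(h;κ))/(2h)`), obtained by
instantiating the tree's model-free Koma–Tasaki / Griffiths core `SourceSandwich` (`SourcedGroundEnergyCusp.lean`,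
hubbard-cq-p5) on the Hellmann–Feynman sandwich of `dWaveSourceTorusTT'Twist` and on the thermodynamic limit
`E₀(dWaveSourceTorusTT'Twist L_j … n_j)/L_j² → e^tw(·;κ)` along every trivial-holonomy sequence
(`DWaveSourceNNNHoppingFlatTwistThermodynamicLimit.lean`). Written for the Hubbard cuprate cell's row T8
(«sourced helicity chord», card `sourced-helicity-chord`, obst-1 g3), whose STRUCTURAL DICTIONARY line
«`−∂_h e(h,q)|_{0⁺} = 2·m⋆_q`, so `lim_{h→0⁺} ΔE(h,q)/(2h) = m⋆₀ − m⋆_q`» is §3 here, as theorems.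

* §1 ONE TWISTED TORUS: the Hellmann–Feynman sandwich `(h' − h)·2L²·m^tw_L(h) ≤ E^tw_L(h) − E^tw_L(h')`
  (`dWaveSourceDensityTT'Twist_mul_le_groundEnergy_drop`), `|m^tw_L| ≤ B_d = 2Σ_e|d(e)/√2|`, monotonicity in `h`,
  concavity of `h ↦ E₀(twist, h)/L²`.
* §2 THE LIMIT along a realising sequence (`L_j → ∞`, `χ_{L_j}(n_{j,i}) = κ_i`): `e^tw(·;κ)` is CONCAVE on `ℝ` and
  `2B_d`-Lipschitz; Griffiths brackets `(e^tw(h₁) − e^tw(h))/(2(h − h₁)) ≤ liminf_j m^tw_j(h)`,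
  `limsup_j m^tw_j(h) ≤ (e^tw(h) − e^tw(h₂))/(2(h₂ − h))`, convergence `m^tw_j(h) → −∂_h e^tw(h;κ)/2` at every
  differentiability point; THE CUSP: **`dWaveOrderParameterTT'Twist_eq_iInf_liminf`** (`m⋆_κ = ⨅_{h>0} liminf_j m^tw_j(h)`),
  **`tendsto_slope_dWaveOrderParameterTT'Twist`** (`(e^tw(0;κ) − e^tw(h;κ))/(2h) → m⋆_κ` as `h → 0⁺`), the
  right-derivative and linear-cusp forms, `0 ≤ m⋆_κ ≤ B_d`; **`dWaveOrderParameterTT'Twist_one`** (`m⋆_1 = m⋆`, no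
  realisability needed) and `…_inv` (`m⋆_{κ⁻¹} = m⋆_κ`).
* §3 THE HELICITY CHORD AT SMALL FIELD: **`tendsto_helicityChordDensity_div`** —
  `(e^tw(h;κ) − e_src(h))/(2h) → m⋆ − m⋆_κ` as `h → 0⁺` (since `e^tw(0;κ) = e_src(0)`); hence `m⋆_κ < m⋆` forces the
  chord density to be eventually POSITIVE at small `h > 0`, `m⋆ < m⋆_κ` (the Fulde–Ferrell source winning) forces it
  eventually NEGATIVE, and `σ ≥ 0` near `0⁺` gives `m⋆_κ ≤ m⋆`. Ladder forms (`b(m+1)`, twists `p(m+1)`) of §2–§3.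

HONEST SCOPE: identities and inequalities between thermodynamic-limit grand-canonical energy densities and the order
parameters they define; nothing here asserts that `m⋆` or any `m⋆_κ` is positive or zero; no number; not a phase
sentence. Everything is PROVED; no definition, no named fact.

## References
* T. Koma, H. Tasaki, J. Stat. Phys. 76 (1994) 745, §1. [cite: KomaTasaki1994, §1]
* R. B. Griffiths, Phys. Rev. 152 (1966) 240, §II. [cite: Griffiths1966, §II]
* R. B. Israel, *Convexity in the Theory of Lattice Gases* (1979), Thm. I.3.4. [cite: Israel1979, Thm. I.3.4]
* M. E. Fisher, M. N. Barber, D. Jasnow, Phys. Rev. A 8 (1973) 1111 (helicity modulus). [cite: FisherBarberJasnow1973]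
* H. Watanabe, J. Stat. Phys. 177 (2019) 717, §2.2.1–§2.2.3. [cite: Watanabe2019, §2.2.3]
-/

noncomputable section

namespace Literature.MathematicalPhysics.QuantumLattice

open _root_.Matrix Finset HubbardWave0 Literature.Probability.LatticeModels _root_.Filter
open scoped _root_.Topology

/-! ### §1 One twisted torus: the Hellmann–Feynman sandwich -/

section OneTorus

variable (L : ℕ) [NeZero L]

/-- The source-free part `H^{tt'}_{twist n} − μN` of the twisted sourced torus is Hermitian. [cite: KomaTasaki1994, §1] -/
theorem isHermitian_hubbardTorusTT'Twist_sub_mu (t' U μ : ℝ) (n : Fin 2 → ZMod L) :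
    (hubbardTorusTT'Twist L t' U n - (μ : ℂ) • totalNumber).IsHermitian := by
  have h := isHermitian_dWaveSourceTorusTT'Twist L t' U μ 0 n
  rwa [dWaveSourceTorusTT'Twist, Complex.ofReal_zero, zero_smul, sub_zero] at h

/-- The twisted sourced torus in the `K − h•O` shape of the sandwich lemmas (definitional). [cite: KomaTasaki1994, §1] -/
theorem dWaveSourceTorusTT'Twist_eq_sub_smul (t' U μ h : ℝ) (n : Fin 2 → ZMod L) :
    dWaveSourceTorusTT'Twist L t' U μ h n =
      (hubbardTorusTT'Twist L t' U n - (μ : ℂ) • totalNumber) -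
        (h : ℂ) • (pairField dWaveFormFactor L + (pairField dWaveFormFactor L)ᴴ) := rfl

/-- `Re ω₀^{tw}(Δ_d + Δ_d†) = 2L² · m^tw_L(h)`. [cite: KomaTasaki1994, §1] -/
theorem re_groundStateFunctional_dWaveSourceTT'Twist_op (t' U μ h : ℝ) (n : Fin 2 → ZMod L) :
    ((dWaveSourceTorusTT'Twist L t' U μ h n).groundStateFunctional
        (pairField dWaveFormFactor L + (pairField dWaveFormFactor L)ᴴ)).re =
      2 * (L : ℝ) ^ 2 * dWaveSourceDensityTT'Twist L t' U μ h n := by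
  have hL : (L : ℝ) ^ 2 ≠ 0 := (cast_sq_pos_of_neZero L).ne'
  rw [map_add, Complex.add_re, groundStateFunctional_conjTranspose_re, dWaveSourceDensityTT'Twist, mul_div_assoc',
    eq_div_iff hL]
  ring

/-- **THE HELLMANN–FEYNMAN SANDWICH on the twisted torus**: `(h' − h)·2L²·m^tw_L(h) ≤ E^tw_L(h) − E^tw_L(h')` for all
real `h, h'` (variational principle with the ground state at `h`). [cite: KomaTasaki1994, §1] -/
theorem dWaveSourceDensityTT'Twist_mul_le_groundEnergy_drop (t' U μ h h' : ℝ) (n : Fin 2 → ZMod L) :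
    (h' - h) * (2 * (L : ℝ) ^ 2 * dWaveSourceDensityTT'Twist L t' U μ h n) ≤
      (dWaveSourceTorusTT'Twist L t' U μ h n).groundEnergy - (dWaveSourceTorusTT'Twist L t' U μ h' n).groundEnergy := by
  have := sub_mul_re_groundStateFunctional_le (isHermitian_hubbardTorusTT'Twist_sub_mu L t' U μ n)
    (isHermitian_pairField_add_conjTranspose L) h h'
  rwa [← dWaveSourceTorusTT'Twist_eq_sub_smul, ← dWaveSourceTorusTT'Twist_eq_sub_smul,
    re_groundStateFunctional_dWaveSourceTT'Twist_op] at this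

/-- The sandwich PER SITE: `(h' − h)·2m^tw_L(h) ≤ E^tw_L(h)/L² − E^tw_L(h')/L²` — the input shape of the core
`SourceSandwich`. [cite: KomaTasaki1994, §1] -/
theorem dWaveSourceDensityTT'Twist_sandwich (t' U μ : ℝ) (n : Fin 2 → ZMod L) (h h' : ℝ) :
    (h' - h) * (2 * dWaveSourceDensityTT'Twist L t' U μ h n) ≤
      (dWaveSourceTorusTT'Twist L t' U μ h n).groundEnergy / (L : ℝ) ^ 2 -
        (dWaveSourceTorusTT'Twist L t' U μ h' n).groundEnergy / (L : ℝ) ^ 2 := by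
  have hL := cast_sq_pos_of_neZero L
  have key := dWaveSourceDensityTT'Twist_mul_le_groundEnergy_drop L t' U μ h h' n
  rw [← sub_div, le_div_iff₀ hL]
  calc (h' - h) * (2 * dWaveSourceDensityTT'Twist L t' U μ h n) * (L : ℝ) ^ 2
      = (h' - h) * (2 * (L : ℝ) ^ 2 * dWaveSourceDensityTT'Twist L t' U μ h n) := by ring
    _ ≤ _ := key

/-- **A priori bound** `|m^tw_L(h)| ≤ B_d = 2Σ_e |d(e)/√2|` (norm of the pair field). [cite: KomaTasaki1994, §1] -/
theorem abs_dWaveSourceDensityTT'Twist_le (t' U μ h : ℝ) (n : Fin 2 → ZMod L) :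
    |dWaveSourceDensityTT'Twist L t' U μ h n| ≤ 2 * ∑ e ∈ insert (0 : Site 2) unitSteps, |dWaveFormFactor e / Real.sqrt 2| := by
  have hL := cast_sq_pos_of_neZero L
  haveI : Nonempty (Finset (Orb (FermionTorus 2 L))) := ⟨∅⟩
  rw [dWaveSourceDensityTT'Twist, abs_div, abs_of_pos hL, div_le_iff₀ hL]
  exact (abs_re_groundStateFunctional_le_norm (isHermitian_dWaveSourceTorusTT'Twist L t' U μ h n) _).trans
    (norm_pairField_le dWaveFormFactor L)

/-- The twisted response density is non-decreasing in the source. [cite: KomaTasaki1994, §1] -/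
theorem dWaveSourceDensityTT'Twist_mono (t' U μ : ℝ) (n : Fin 2 → ZMod L) :
    Monotone fun h => dWaveSourceDensityTT'Twist L t' U μ h n :=
  SourceSandwich.monotone (dWaveSourceDensityTT'Twist_sandwich L t' U μ n)

/-- The twisted sourced ground energy per site is concave in the source. [cite: KomaTasaki1994, §1] -/
theorem concaveOn_groundEnergy_dWaveSourceTorusTT'Twist_div_sq (t' U μ : ℝ) (n : Fin 2 → ZMod L) :
    ConcaveOn ℝ Set.univ fun h => (dWaveSourceTorusTT'Twist L t' U μ h n).groundEnergy / (L : ℝ) ^ 2 :=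
  SourceSandwich.concaveOn_univ (dWaveSourceDensityTT'Twist_sandwich L t' U μ n)

end OneTorus

/-! ### §2 The limit along a realising sequence: concavity, Lipschitz continuity, Griffiths brackets, the cusp -/

section Limit

variable (t' U μ : ℝ) (κ : Fin 2 → Circle) (Ls : ℕ → ℕ) [∀ j, NeZero (Ls j)] (hLs : Tendsto Ls atTop atTop)
  (n : ∀ j, Fin 2 → ZMod (Ls j)) (hn : ∀ j i, ZMod.toCircle (n j i) = κ i)

/-- The sandwich along the sequence, in the core's shape. [cite: KomaTasaki1994, §1] -/
private theorem seq_sandwich :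
    ∀ (j : ℕ) (h h' : ℝ), (h' - h) * (2 * dWaveSourceDensityTT'Twist (Ls j) t' U μ h (n j)) ≤
      (dWaveSourceTorusTT'Twist (Ls j) t' U μ h (n j)).groundEnergy / ((Ls j : ℕ) : ℝ) ^ 2 -
        (dWaveSourceTorusTT'Twist (Ls j) t' U μ h' (n j)).groundEnergy / ((Ls j : ℕ) : ℝ) ^ 2 :=
  fun j h h' => dWaveSourceDensityTT'Twist_sandwich (Ls j) t' U μ (n j) h h'

/-- The a priori bound along the sequence, in the core's shape. [cite: KomaTasaki1994, §1] -/
private theorem seq_bound :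
    ∀ (j : ℕ) (h : ℝ), |dWaveSourceDensityTT'Twist (Ls j) t' U μ h (n j)| ≤
      2 * ∑ e ∈ insert (0 : Site 2) unitSteps, |dWaveFormFactor e / Real.sqrt 2| :=
  fun j h => abs_dWaveSourceDensityTT'Twist_le (Ls j) t' U μ h (n j)

include hLs hn in
/-- **`e^tw(·;κ)` is CONCAVE on `ℝ`** for every `κ` realised on a trivial-holonomy sequence (pointwise limit of the
concave `E^tw_L(·)/L²`). [cite: KomaTasaki1994, §1] -/
theorem concaveOn_dWaveSourceEnergyDensityTT'Twist :
    ConcaveOn ℝ Set.univ fun h => dWaveSourceEnergyDensityTT'Twist t' U μ h κ := by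
  refine ⟨convex_univ, fun x _ y _ p q hp hq hpq => ?_⟩
  simp only [smul_eq_mul]
  have hlim := ((tendsto_groundEnergy_dWaveSourceTorusTT'Twist_div_sq t' U μ x κ Ls hLs n hn).const_mul p).add
    ((tendsto_groundEnergy_dWaveSourceTorusTT'Twist_div_sq t' U μ y κ Ls hLs n hn).const_mul q)
  refine le_of_tendsto_of_tendsto' hlim
    (tendsto_groundEnergy_dWaveSourceTorusTT'Twist_div_sq t' U μ (p * x + q * y) κ Ls hLs n hn) fun j => ?_
  have := (concaveOn_groundEnergy_dWaveSourceTorusTT'Twist_div_sq (Ls j) t' U μ (n j)).2 (Set.mem_univ x)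
    (Set.mem_univ y) hp hq hpq
  simpa only [smul_eq_mul] using this

include hLs hn in
/-- **`e^tw(·;κ)` is `2B_d`-Lipschitz**: `|e^tw(h;κ) − e^tw(h';κ)| ≤ 2B_d|h − h'|`. [cite: Israel1979, Thm. I.3.4] -/
theorem abs_dWaveSourceEnergyDensityTT'Twist_sub_le (h h' : ℝ) :
    |dWaveSourceEnergyDensityTT'Twist t' U μ h κ - dWaveSourceEnergyDensityTT'Twist t' U μ h' κ| ≤
      2 * (2 * ∑ e ∈ insert (0 : Site 2) unitSteps, |dWaveFormFactor e / Real.sqrt 2|) * |h - h'| :=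
  SourceSandwich.abs_sub_le_of_tendsto (g := fun h => dWaveSourceEnergyDensityTT'Twist t' U μ h κ)
    (seq_sandwich t' U μ Ls n) (seq_bound t' U μ Ls n)
    (tendsto_groundEnergy_dWaveSourceTorusTT'Twist_div_sq t' U μ h κ Ls hLs n hn)
    (tendsto_groundEnergy_dWaveSourceTorusTT'Twist_div_sq t' U μ h' κ Ls hLs n hn)

include hLs hn in
/-- Hence `e^tw(·;κ)` is continuous. [cite: Israel1979, Thm. I.3.4] -/
theorem continuous_dWaveSourceEnergyDensityTT'Twist :
    Continuous fun h => dWaveSourceEnergyDensityTT'Twist t' U μ h κ := by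
  have hK : (0 : ℝ) ≤ 2 * (2 * ∑ e ∈ insert (0 : Site 2) unitSteps, |dWaveFormFactor e / Real.sqrt 2|) := by
    positivity
  refine (LipschitzWith.of_dist_le_mul (K := ⟨_, hK⟩) fun h h' => ?_).continuous
  rw [Real.dist_eq, Real.dist_eq]
  exact abs_dWaveSourceEnergyDensityTT'Twist_sub_le t' U μ κ Ls hLs n hn h h'

include hLs hn in
/-- **Griffiths bracket, floor**: for `h₁ < h`, `(e^tw(h₁;κ) − e^tw(h;κ))/(2(h − h₁)) ≤ liminf_j m^tw_j(h)`.
[cite: Griffiths1966, §II] -/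
theorem slope_le_liminf_dWaveSourceDensityTT'Twist {h₁ h : ℝ} (hlt : h₁ < h) :
    (dWaveSourceEnergyDensityTT'Twist t' U μ h₁ κ - dWaveSourceEnergyDensityTT'Twist t' U μ h κ) / (2 * (h - h₁)) ≤
      liminf (fun j => dWaveSourceDensityTT'Twist (Ls j) t' U μ h (n j)) atTop :=
  SourceSandwich.slope_le_liminf (g := fun h => dWaveSourceEnergyDensityTT'Twist t' U μ h κ)
    (seq_sandwich t' U μ Ls n) (seq_bound t' U μ Ls n) hlt
    (tendsto_groundEnergy_dWaveSourceTorusTT'Twist_div_sq t' U μ h₁ κ Ls hLs n hn)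
    (tendsto_groundEnergy_dWaveSourceTorusTT'Twist_div_sq t' U μ h κ Ls hLs n hn)

include hLs hn in
/-- **Griffiths bracket, ceiling**: for `h < h₂`, `limsup_j m^tw_j(h) ≤ (e^tw(h;κ) − e^tw(h₂;κ))/(2(h₂ − h))`.
[cite: Griffiths1966, §II] -/
theorem limsup_dWaveSourceDensityTT'Twist_le_slope {h h₂ : ℝ} (hlt : h < h₂) :
    limsup (fun j => dWaveSourceDensityTT'Twist (Ls j) t' U μ h (n j)) atTop ≤
      (dWaveSourceEnergyDensityTT'Twist t' U μ h κ - dWaveSourceEnergyDensityTT'Twist t' U μ h₂ κ) / (2 * (h₂ - h)) :=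
  SourceSandwich.limsup_le_slope (g := fun h => dWaveSourceEnergyDensityTT'Twist t' U μ h κ)
    (seq_sandwich t' U μ Ls n) (seq_bound t' U μ Ls n) hlt
    (tendsto_groundEnergy_dWaveSourceTorusTT'Twist_div_sq t' U μ h κ Ls hLs n hn)
    (tendsto_groundEnergy_dWaveSourceTorusTT'Twist_div_sq t' U μ h₂ κ Ls hLs n hn)

include hLs hn in
/-- **Griffiths' lemma on the twisted torus**: at a differentiability point `h` of `e^tw(·;κ)` with derivative `e'`,
the twisted response densities CONVERGE, `m^tw_j(h) → −e'/2`. [cite: Griffiths1966, §II] -/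
theorem tendsto_dWaveSourceDensityTT'Twist_of_hasDerivAt {h e' : ℝ}
    (hd : HasDerivAt (fun h => dWaveSourceEnergyDensityTT'Twist t' U μ h κ) e' h) :
    Tendsto (fun j => dWaveSourceDensityTT'Twist (Ls j) t' U μ h (n j)) atTop (𝓝 (-e' / 2)) :=
  SourceSandwich.tendsto_of_hasDerivAt (g := fun h => dWaveSourceEnergyDensityTT'Twist t' U μ h κ)
    (seq_sandwich t' U μ Ls n) (seq_bound t' U μ Ls n)
    (Eventually.of_forall fun h' => tendsto_groundEnergy_dWaveSourceTorusTT'Twist_div_sq t' U μ h' κ Ls hLs n hn) hd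

include hLs hn in
/-- **THE CUSP IDENTITY, infimum form**: `m⋆_κ = ⨅_{h>0} liminf_j m^tw_j(h)` — the FF/PDW order parameter defined
through the energy IS the Koma–Tasaki double limit of the twisted response densities, along every realising sequence.
[cite: KomaTasaki1994, §1] -/
theorem dWaveOrderParameterTT'Twist_eq_iInf_liminf :
    dWaveOrderParameterTT'Twist t' U μ κ =
      ⨅ h : Set.Ioi (0 : ℝ), liminf (fun j => dWaveSourceDensityTT'Twist (Ls j) t' U μ h (n j)) atTop := by
  rw [dWaveOrderParameterTT'Twist]
  exact (SourceSandwich.iInf_liminf_eq_iInf_slope (g := fun h => dWaveSourceEnergyDensityTT'Twist t' U μ h κ)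
    (seq_sandwich t' U μ Ls n) (seq_bound t' U μ Ls n)
    (fun h _ => tendsto_groundEnergy_dWaveSourceTorusTT'Twist_div_sq t' U μ h κ Ls hLs n hn)).symm

include hLs hn in
/-- **THE CUSP IDENTITY, limit form**: `(e^tw(0;κ) − e^tw(h;κ))/(2h) → m⋆_κ` as `h → 0⁺` (a monotone secant of the
concave `e^tw(·;κ)`). [cite: KomaTasaki1994, §1] -/
theorem tendsto_slope_dWaveOrderParameterTT'Twist :
    Tendsto (fun h : ℝ =>
        (dWaveSourceEnergyDensityTT'Twist t' U μ 0 κ - dWaveSourceEnergyDensityTT'Twist t' U μ h κ) / (2 * h))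
      (𝓝[>] 0) (𝓝 (dWaveOrderParameterTT'Twist t' U μ κ)) := by
  have key := SourceSandwich.tendsto_slope_nhdsGT (g := fun h => dWaveSourceEnergyDensityTT'Twist t' U μ h κ)
    (seq_sandwich t' U μ Ls n) (seq_bound t' U μ Ls n)
    (fun h _ => tendsto_groundEnergy_dWaveSourceTorusTT'Twist_div_sq t' U μ h κ Ls hLs n hn)
  rw [dWaveOrderParameterTT'Twist_eq_iInf_liminf t' U μ κ Ls hLs n hn]
  exact key

include hLs hn in
/-- **THE CUSP IDENTITY, derivative form**: a right derivative `e'₊(0)` of `e^tw(·;κ)` at `0` gives `m⋆_κ = −e'₊(0)/2`.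
[cite: Griffiths1966, §II] -/
theorem dWaveOrderParameterTT'Twist_eq_neg_half_rightDeriv {e' : ℝ}
    (hd : HasDerivWithinAt (fun h => dWaveSourceEnergyDensityTT'Twist t' U μ h κ) e' (Set.Ioi 0) 0) :
    dWaveOrderParameterTT'Twist t' U μ κ = -e' / 2 := by
  have key := SourceSandwich.iInf_liminf_eq_neg_half_deriv (g := fun h => dWaveSourceEnergyDensityTT'Twist t' U μ h κ)
    (seq_sandwich t' U μ Ls n) (seq_bound t' U μ Ls n)
    (fun h _ => tendsto_groundEnergy_dWaveSourceTorusTT'Twist_div_sq t' U μ h κ Ls hLs n hn) hd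
  rw [dWaveOrderParameterTT'Twist_eq_iInf_liminf t' U μ κ Ls hLs n hn]
  exact key

include hLs hn in
/-- **FF/PDW order IS a linear cusp of `e^tw(·;κ)`**: `0 < m⋆_κ ↔ ∃ c > 0, ∀ h > 0, e^tw(h;κ) ≤ e^tw(0;κ) − 2ch`.
[cite: KomaTasaki1994, §1] -/
theorem dWaveOrderParameterTT'Twist_pos_iff_linear_cusp :
    0 < dWaveOrderParameterTT'Twist t' U μ κ ↔ ∃ c : ℝ, 0 < c ∧ ∀ h : ℝ, 0 < h →
      dWaveSourceEnergyDensityTT'Twist t' U μ h κ ≤ dWaveSourceEnergyDensityTT'Twist t' U μ 0 κ - 2 * c * h := by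
  have key := SourceSandwich.iInf_liminf_pos_iff_linear_cusp (g := fun h => dWaveSourceEnergyDensityTT'Twist t' U μ h κ)
    (seq_sandwich t' U μ Ls n) (seq_bound t' U μ Ls n)
    (fun h _ => tendsto_groundEnergy_dWaveSourceTorusTT'Twist_div_sq t' U μ h κ Ls hLs n hn)
  rw [dWaveOrderParameterTT'Twist_eq_iInf_liminf t' U μ κ Ls hLs n hn]
  exact key

include hLs hn in
/-- The secants are non-negative: `0 ≤ (e^tw(0;κ) − e^tw(h;κ))/(2h)` for `h > 0` (the source only lowers the twisted
energy density). [cite: KomaTasaki1994, §1] -/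
theorem slope_dWaveSourceEnergyDensityTT'Twist_nonneg {h : ℝ} (hh : 0 < h) :
    0 ≤ (dWaveSourceEnergyDensityTT'Twist t' U μ 0 κ - dWaveSourceEnergyDensityTT'Twist t' U μ h κ) / (2 * h) :=
  div_nonneg (sub_nonneg.2 (dWaveSourceEnergyDensityTT'Twist_le_zero_field_twist t' U μ h κ Ls hLs n hn)) (by positivity)

include hLs hn in
/-- **`0 ≤ m⋆_κ`**. [cite: KomaTasaki1994, §1] -/
theorem dWaveOrderParameterTT'Twist_nonneg : 0 ≤ dWaveOrderParameterTT'Twist t' U μ κ := by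
  haveI : Nonempty (Set.Ioi (0 : ℝ)) := ⟨⟨1, Set.mem_Ioi.2 one_pos⟩⟩
  rw [dWaveOrderParameterTT'Twist]
  exact le_ciInf fun h => slope_dWaveSourceEnergyDensityTT'Twist_nonneg t' U μ κ Ls hLs n hn h.2

include hLs hn in
/-- **ONE-CHORD CEILING `m⋆_κ ≤ (e^tw(0;κ) − e^tw(h;κ))/(2h)`** at every `h > 0` (the secant decreases to `m⋆_κ`).
[cite: KomaTasaki1994, §1] -/
theorem dWaveOrderParameterTT'Twist_le_slope {h : ℝ} (hh : 0 < h) :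
    dWaveOrderParameterTT'Twist t' U μ κ ≤
      (dWaveSourceEnergyDensityTT'Twist t' U μ 0 κ - dWaveSourceEnergyDensityTT'Twist t' U μ h κ) / (2 * h) := by
  have hbdd : BddBelow (Set.range fun h' : Set.Ioi (0 : ℝ) =>
      (dWaveSourceEnergyDensityTT'Twist t' U μ 0 κ - dWaveSourceEnergyDensityTT'Twist t' U μ h' κ) / (2 * (h' : ℝ))) :=
    ⟨0, by rintro _ ⟨h', rfl⟩; exact slope_dWaveSourceEnergyDensityTT'Twist_nonneg t' U μ κ Ls hLs n hn h'.2⟩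
  have key := ciInf_le hbdd ⟨h, hh⟩
  rw [dWaveOrderParameterTT'Twist]
  exact key

include hLs hn in
/-- **`m⋆_κ ≤ B_d`** (the secant at `h = 1` and the Lipschitz bound). [cite: KomaTasaki1994, §1] -/
theorem dWaveOrderParameterTT'Twist_le :
    dWaveOrderParameterTT'Twist t' U μ κ ≤ 2 * ∑ e ∈ insert (0 : Site 2) unitSteps, |dWaveFormFactor e / Real.sqrt 2| := by
  have h1 := dWaveOrderParameterTT'Twist_le_slope t' U μ κ Ls hLs n hn one_pos
  have h2 := abs_dWaveSourceEnergyDensityTT'Twist_sub_le t' U μ κ Ls hLs n hn 0 1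
  rw [zero_sub, abs_neg, abs_one, mul_one] at h2
  have h3 := le_abs_self (dWaveSourceEnergyDensityTT'Twist t' U μ 0 κ - dWaveSourceEnergyDensityTT'Twist t' U μ 1 κ)
  rw [mul_one] at h1
  linarith

include hLs hn in
/-- **ONE-CHORD CEILING FROM CERTIFIED WINDOWS**: an upper bound `e_src(t',U,μ,0) ≤ hi₀` on the sourceless energy
density (`= e^tw(0;κ)`) and a lower bound `lo ≤ e^tw(h;κ)` on the twisted one at a field `h > 0` (e.g. a
constant-phase sourced floor certificate on the twisted tori of the ladder, passed to the limit) CAP the FF/PDW order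
parameter: `m⋆_κ ≤ (hi₀ − lo)/(2h)` — the ABSENT-side instrument for pair-density-wave order, verbatim the shape of the
untwisted `dWaveOrderParameterTT' ≤ (hi₀ − lo_h)/(2h)`. [cite: KomaTasaki1994, §1] -/
theorem dWaveOrderParameterTT'Twist_le_of_windows {h hi₀ lo : ℝ} (hh : 0 < h)
    (hhi : dWaveSourceEnergyDensityTT' t' U μ 0 ≤ hi₀) (hlo : lo ≤ dWaveSourceEnergyDensityTT'Twist t' U μ h κ) :
    dWaveOrderParameterTT'Twist t' U μ κ ≤ (hi₀ - lo) / (2 * h) := by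
  refine (dWaveOrderParameterTT'Twist_le_slope t' U μ κ Ls hLs n hn hh).trans
    (div_le_div_of_nonneg_right ?_ (by positivity))
  rw [dWaveSourceEnergyDensityTT'Twist_zero_source t' U μ κ Ls hLs n hn]
  linarith

/-- **At `κ = 1` the FF/PDW order parameter is the uniform `d`-wave order parameter**: `m⋆_1 = dWaveOrderParameterTT' t' U μ`
(both are the cusp of `e_src`; no realisability hypothesis). [cite: KomaTasaki1994, §1] -/
theorem dWaveOrderParameterTT'Twist_one : dWaveOrderParameterTT'Twist t' U μ 1 = dWaveOrderParameterTT' t' U μ := by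
  rw [dWaveOrderParameterTT'Twist, dWaveOrderParameterTT'_eq_iInf_slope_energyDensity]
  simp_rw [dWaveSourceEnergyDensityTT'Twist_one]

include hLs hn in
/-- **Twist reversal**: `m⋆_{κ⁻¹} = m⋆_κ`. [cite: KomaTasaki1994, §1] -/
theorem dWaveOrderParameterTT'Twist_inv : dWaveOrderParameterTT'Twist t' U μ κ⁻¹ = dWaveOrderParameterTT'Twist t' U μ κ := by
  rw [dWaveOrderParameterTT'Twist, dWaveOrderParameterTT'Twist]
  simp_rw [dWaveSourceEnergyDensityTT'Twist_inv t' U μ _ κ Ls hLs n hn]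

end Limit

/-! ### §3 The helicity chord density at small field: `σ(h;κ)/(2h) → m⋆ − m⋆_κ` -/

section Chord

variable (t' U μ : ℝ) (κ : Fin 2 → Circle) (Ls : ℕ → ℕ) [∀ j, NeZero (Ls j)] (hLs : Tendsto Ls atTop atTop)
  (n : ∀ j, Fin 2 → ZMod (Ls j)) (hn : ∀ j i, ZMod.toCircle (n j i) = κ i)

include hLs hn in
/-- **THE SMALL-FIELD SLOPE OF THE HELICITY CHORD DENSITY IS THE DEFICIT OF PAIR-DENSITY-WAVE ORDER**:
`(e^tw(h;κ) − e_src(h))/(2h) → m⋆ − m⋆_κ` as `h → 0⁺` (`e^tw(0;κ) = e_src(0)`, and the two secants converge to the two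
cusps). The card's «`lim_{h→0⁺} ΔE(h,q)/(2h) = m⋆₀ − m⋆_q`». [cite: KomaTasaki1994, §1] -/
theorem tendsto_helicityChordDensity_div :
    Tendsto (fun h : ℝ => (dWaveSourceEnergyDensityTT'Twist t' U μ h κ - dWaveSourceEnergyDensityTT' t' U μ h) / (2 * h))
      (𝓝[>] 0) (𝓝 (dWaveOrderParameterTT' t' U μ - dWaveOrderParameterTT'Twist t' U μ κ)) := by
  have h0 := dWaveSourceEnergyDensityTT'Twist_zero_source t' U μ κ Ls hLs n hn
  refine ((tendsto_slope_energyDensity_dWaveOrderParameterTT' t' U μ).sub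
    (tendsto_slope_dWaveOrderParameterTT'Twist t' U μ κ Ls hLs n hn)).congr fun h => ?_
  rw [h0, ← sub_div]
  ring_nf

include hLs hn in
/-- **Deficient PDW order makes the chord positive at small field**: `m⋆_κ < m⋆ ⇒ ∀ᶠ h → 0⁺, 0 < e^tw(h;κ) − e_src(h)`.
[cite: FisherBarberJasnow1973] -/
theorem eventually_helicityChordDensity_pos (hlt : dWaveOrderParameterTT'Twist t' U μ κ < dWaveOrderParameterTT' t' U μ) :
    ∀ᶠ h : ℝ in 𝓝[>] 0, 0 < dWaveSourceEnergyDensityTT'Twist t' U μ h κ - dWaveSourceEnergyDensityTT' t' U μ h := by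
  have hlim := tendsto_helicityChordDensity_div t' U μ κ Ls hLs n hn
  have hev := hlim.eventually (Ioi_mem_nhds (sub_pos.2 hlt))
  filter_upwards [hev, self_mem_nhdsWithin] with h hh hpos
  have hpos' : (0 : ℝ) < h := hpos
  exact (div_pos_iff_of_pos_right (by positivity)).1 hh

include hLs hn in
/-- **Excess PDW order makes the chord NEGATIVE at small field** (the spiral source wins):
`m⋆ < m⋆_κ ⇒ ∀ᶠ h → 0⁺, e^tw(h;κ) − e_src(h) < 0`. [cite: FisherBarberJasnow1973] -/
theorem eventually_helicityChordDensity_neg (hlt : dWaveOrderParameterTT' t' U μ < dWaveOrderParameterTT'Twist t' U μ κ) :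
    ∀ᶠ h : ℝ in 𝓝[>] 0, dWaveSourceEnergyDensityTT'Twist t' U μ h κ - dWaveSourceEnergyDensityTT' t' U μ h < 0 := by
  have hlim := tendsto_helicityChordDensity_div t' U μ κ Ls hLs n hn
  have hev := hlim.eventually (Iio_mem_nhds (sub_neg.2 hlt))
  filter_upwards [hev, self_mem_nhdsWithin] with h hh hpos
  have hpos' : (0 : ℝ) < h := hpos
  have h2 : (0 : ℝ) < 2 * h := by positivity
  rcases lt_or_ge (dWaveSourceEnergyDensityTT'Twist t' U μ h κ - dWaveSourceEnergyDensityTT' t' U μ h) 0 with hlt' | hge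
  · exact hlt'
  · exact absurd hh (not_lt.2 (div_nonneg hge h2.le))

include hLs hn in
/-- **A non-negative chord near `0⁺` bounds the PDW order parameter by the uniform one**:
`(∀ᶠ h → 0⁺, 0 ≤ e^tw(h;κ) − e_src(h)) ⇒ m⋆_κ ≤ m⋆`. [cite: KomaTasaki1994, §1] -/
theorem dWaveOrderParameterTT'Twist_le_of_eventually_nonneg
    (hσ : ∀ᶠ h : ℝ in 𝓝[>] 0, 0 ≤ dWaveSourceEnergyDensityTT'Twist t' U μ h κ - dWaveSourceEnergyDensityTT' t' U μ h) :
    dWaveOrderParameterTT'Twist t' U μ κ ≤ dWaveOrderParameterTT' t' U μ := by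
  have hlim := tendsto_helicityChordDensity_div t' U μ κ Ls hLs n hn
  have key : (0 : ℝ) ≤ dWaveOrderParameterTT' t' U μ - dWaveOrderParameterTT'Twist t' U μ κ := by
    refine ge_of_tendsto hlim ?_
    filter_upwards [hσ, self_mem_nhdsWithin] with h hh hpos
    have hpos' : (0 : ℝ) < h := hpos
    exact div_nonneg hh (by positivity)
  linarith

include hLs hn in
/-- **A non-positive chord near `0⁺` bounds the uniform order parameter by the PDW one**:
`(∀ᶠ h → 0⁺, e^tw(h;κ) − e_src(h) ≤ 0) ⇒ m⋆ ≤ m⋆_κ`. [cite: KomaTasaki1994, §1] -/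
theorem dWaveOrderParameterTT'_le_twist_of_eventually_nonpos
    (hσ : ∀ᶠ h : ℝ in 𝓝[>] 0, dWaveSourceEnergyDensityTT'Twist t' U μ h κ - dWaveSourceEnergyDensityTT' t' U μ h ≤ 0) :
    dWaveOrderParameterTT' t' U μ ≤ dWaveOrderParameterTT'Twist t' U μ κ := by
  have hlim := tendsto_helicityChordDensity_div t' U μ κ Ls hLs n hn
  have key : dWaveOrderParameterTT' t' U μ - dWaveOrderParameterTT'Twist t' U μ κ ≤ 0 := by
    refine le_of_tendsto hlim ?_
    filter_upwards [hσ, self_mem_nhdsWithin] with h hh hpos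
    have hpos' : (0 : ℝ) < h := hpos
    exact div_nonpos_of_nonpos_of_nonneg hh (by positivity)
  linarith

end Chord

/-! ### §4 Ladder forms (`L = b(m+1)`, twists `p(m+1)`, `q = 4πp/b`) -/

section Ladder

variable (t' U μ : ℝ) (b : ℕ) [NeZero b] (p : Fin 2 → ℕ)

/-- The ladder sides diverge. [folklore] -/
private theorem tendsto_ladder_sides : Tendsto (fun m : ℕ => b * (m + 1)) atTop atTop :=
  (tendsto_add_atTop_nat 1).const_mul_atTop' (Nat.pos_of_ne_zero (NeZero.ne b))

/-- `e^tw(·; χ_b(p))` is concave on `ℝ`. [cite: KomaTasaki1994, §1] -/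
theorem concaveOn_dWaveSourceEnergyDensityTT'Twist_ladder :
    ConcaveOn ℝ Set.univ fun h => dWaveSourceEnergyDensityTT'Twist t' U μ h (fun i => ZMod.toCircle ((p i : ℕ) : ZMod b)) :=
  concaveOn_dWaveSourceEnergyDensityTT'Twist t' U μ _ (fun m => b * (m + 1)) (tendsto_ladder_sides b)
    (fun m i => ((p i * (m + 1) : ℕ) : ZMod (b * (m + 1)))) (fun m i => toCircle_mul_eq b (m + 1) (p i))

/-- **The cusp identity along the ladder**: `(e^tw(0;χ_b(p)) − e^tw(h;χ_b(p)))/(2h) → m⋆_{χ_b(p)}` as `h → 0⁺`.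
[cite: KomaTasaki1994, §1] -/
theorem tendsto_slope_dWaveOrderParameterTT'Twist_ladder :
    Tendsto (fun h : ℝ => (dWaveSourceEnergyDensityTT'Twist t' U μ 0 (fun i => ZMod.toCircle ((p i : ℕ) : ZMod b)) -
        dWaveSourceEnergyDensityTT'Twist t' U μ h (fun i => ZMod.toCircle ((p i : ℕ) : ZMod b))) / (2 * h))
      (𝓝[>] 0) (𝓝 (dWaveOrderParameterTT'Twist t' U μ fun i => ZMod.toCircle ((p i : ℕ) : ZMod b))) :=
  tendsto_slope_dWaveOrderParameterTT'Twist t' U μ _ (fun m => b * (m + 1)) (tendsto_ladder_sides b)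
    (fun m i => ((p i * (m + 1) : ℕ) : ZMod (b * (m + 1)))) (fun m i => toCircle_mul_eq b (m + 1) (p i))

/-- **`m⋆_{χ_b(p)} = ⨅_{h>0} liminf_m m^tw_{b(m+1)}(h)`** along the ladder (the Koma–Tasaki double limit of the twisted
response densities). [cite: KomaTasaki1994, §1] -/
theorem dWaveOrderParameterTT'Twist_ladder_eq_iInf_liminf :
    dWaveOrderParameterTT'Twist t' U μ (fun i => ZMod.toCircle ((p i : ℕ) : ZMod b)) =
      ⨅ h : Set.Ioi (0 : ℝ), liminf (fun m : ℕ => dWaveSourceDensityTT'Twist (b * (m + 1)) t' U μ h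
        (fun i => ((p i * (m + 1) : ℕ) : ZMod (b * (m + 1))))) atTop :=
  dWaveOrderParameterTT'Twist_eq_iInf_liminf t' U μ _ (fun m => b * (m + 1)) (tendsto_ladder_sides b)
    (fun m i => ((p i * (m + 1) : ℕ) : ZMod (b * (m + 1)))) (fun m i => toCircle_mul_eq b (m + 1) (p i))

/-- `0 ≤ m⋆_{χ_b(p)} ≤ B_d`. [cite: KomaTasaki1994, §1] -/
theorem dWaveOrderParameterTT'Twist_ladder_mem_Icc :
    dWaveOrderParameterTT'Twist t' U μ (fun i => ZMod.toCircle ((p i : ℕ) : ZMod b)) ∈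
      Set.Icc 0 (2 * ∑ e ∈ insert (0 : Site 2) unitSteps, |dWaveFormFactor e / Real.sqrt 2|) :=
  ⟨dWaveOrderParameterTT'Twist_nonneg t' U μ _ (fun m => b * (m + 1)) (tendsto_ladder_sides b)
      (fun m i => ((p i * (m + 1) : ℕ) : ZMod (b * (m + 1)))) (fun m i => toCircle_mul_eq b (m + 1) (p i)),
    dWaveOrderParameterTT'Twist_le t' U μ _ (fun m => b * (m + 1)) (tendsto_ladder_sides b)
      (fun m i => ((p i * (m + 1) : ℕ) : ZMod (b * (m + 1)))) (fun m i => toCircle_mul_eq b (m + 1) (p i))⟩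

/-- **Certified windows cap the PDW order parameter of a ladder**: `e_src(0) ≤ hi₀` and `lo ≤ e^tw(h; χ_b(p))`
(`h > 0`) give `m⋆_{χ_b(p)} ≤ (hi₀ − lo)/(2h)`. [cite: KomaTasaki1994, §1] -/
theorem dWaveOrderParameterTT'Twist_ladder_le_of_windows {h hi₀ lo : ℝ} (hh : 0 < h)
    (hhi : dWaveSourceEnergyDensityTT' t' U μ 0 ≤ hi₀)
    (hlo : lo ≤ dWaveSourceEnergyDensityTT'Twist t' U μ h (fun i => ZMod.toCircle ((p i : ℕ) : ZMod b))) :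
    dWaveOrderParameterTT'Twist t' U μ (fun i => ZMod.toCircle ((p i : ℕ) : ZMod b)) ≤ (hi₀ - lo) / (2 * h) :=
  dWaveOrderParameterTT'Twist_le_of_windows t' U μ _ (fun m => b * (m + 1)) (tendsto_ladder_sides b)
    (fun m i => ((p i * (m + 1) : ℕ) : ZMod (b * (m + 1)))) (fun m i => toCircle_mul_eq b (m + 1) (p i)) hh hhi hlo

/-- **The headline along the ladder**: `(e^tw(h;χ_b(p)) − e_src(h))/(2h) → m⋆ − m⋆_{χ_b(p)}` as `h → 0⁺`.
[cite: KomaTasaki1994, §1] -/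
theorem tendsto_helicityChordDensity_div_ladder :
    Tendsto (fun h : ℝ => (dWaveSourceEnergyDensityTT'Twist t' U μ h (fun i => ZMod.toCircle ((p i : ℕ) : ZMod b)) -
        dWaveSourceEnergyDensityTT' t' U μ h) / (2 * h))
      (𝓝[>] 0) (𝓝 (dWaveOrderParameterTT' t' U μ -
        dWaveOrderParameterTT'Twist t' U μ fun i => ZMod.toCircle ((p i : ℕ) : ZMod b))) :=
  tendsto_helicityChordDensity_div t' U μ _ (fun m => b * (m + 1)) (tendsto_ladder_sides b)
    (fun m i => ((p i * (m + 1) : ℕ) : ZMod (b * (m + 1)))) (fun m i => toCircle_mul_eq b (m + 1) (p i))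

end Ladder

end Literature.MathematicalPhysics.QuantumLattice

end
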